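import Summits.CriticalPhenomena.PercolationContinuityZ3.Theorems.PercNearOneGluingNoHeavyLowerTailMajorityGluingQCertSym3TypeZParts
import HarnessLib

/-!
# Spec-only degree-3 orbit certificates, III: MERGE-BUILT count tables (`stepM`) and the fast digest `digestZ2` (lane prim-rate, constants-miner 1, gen 38)

Support file for the closed crux `NoHeavyLowerTail` (stmt-CriticalPhenomena-4575), majority-gluing line.  The relay-by-relay count tables of `…QCertSym3CountBridge`
(`tabM`, `tabF`) and `…QCertSym3TypeZ` (`tabG`) SORT the branched table (`msort2 fuel (stepU …)`, `n log n` with the merge-sort constant) after every relay.  But a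
table is sorted by code, and shifting all codes by the constant `Bs^v` keeps it sorted — so one relay step is a `|cells|`-way MERGE of shifted copies (`stepM`: `merge2` of
`shiftTab (Bs^v)`, linear), followed by the run aggregation `aggr`.  Soundness needs no sortedness at all: `evalC_stepM : evalC g (stepM Bs cells l) = evalC g (stepU Bs cells l)`
(`merge2_perm`), hence `tabM2`/`tabF2`/`tabG2` evaluate like `tabU`/`tabF`/`tabG`, and the fast contribution list `contribsZ2` (`prodY2`, `rowY2`, `linY2`, `ell2Y2`, `pairY2`, `sqY2`)
evaluates like `contribsZ` (`evalC_contribsZ2`, entry by entry, no hypotheses).  `digestZ2`, `evalC_digestZ2`, and the gluing theorems `pos_of_digestsZ2` /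
`pos_of_superdigestsZ2` mirror `…QCertSym3TypeZParts` (parts state `d.digestZ2 fuel = D` by `decide +kernel`; the glue and the theorem file are unchanged otherwise).
Kernel smoke test: `zSmoke3_digestZ2` (`digestZ2 = digestZ` on the m = 3 smoke part).  No sorries.
-/

namespace Summit.CriticalPhenomena.PercolationContinuityZ3.Theorems

namespace HubOnly
namespace QCert

/-! ### Merge-built table steps -/

/-- All codes shifted by `s` (order and coefficients kept). -/
def shiftTab (s : ℕ) (l : List (ℕ × ℤ)) : List (ℕ × ℤ) := l.map fun e => (e.1 + s, e.2)

/-- **One relay step by merging**: the `|cells|` shifted copies of the table merged by key (each copy is sorted when the table is). -/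
def stepM (Bs : ℕ) : List ℕ → List (ℕ × ℤ) → List (ℕ × ℤ)
  | [], _ => []
  | v :: cells, l => merge2 (shiftTab (Bs ^ v) l) (stepM Bs cells l)

/-- The two-slot table built with merge steps. -/
def tabM2 (Bs A X B Y t : ℕ) : ℕ → List (ℕ × ℤ)
  | 0 => [(0, 1)]
  | n + 1 => aggr (stepM Bs (cellsAt A X B Y t n) (tabM2 Bs A X B Y t n))

/-- The one-slot (first slot varying) table built with merge steps. -/
def tabF2 (Bs A X a b : ℕ) : ℕ → List (ℕ × ℤ)
  | 0 => [(0, 1)]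
  | n + 1 => aggr (stepM Bs (cellsAtF A X a b n) (tabF2 Bs A X a b n))

/-- The middle-slot table built with merge steps. -/
def tabG2 (Bs A X a b : ℕ) : ℕ → List (ℕ × ℤ)
  | 0 => [(0, 1)]
  | n + 1 => aggr (stepM Bs (cellsAtG A X a b n) (tabG2 Bs A X a b n))

noncomputable section

/-- Evaluating a shifted table. -/
theorem evalC_shiftTab (g : ℕ → ℝ) (s : ℕ) (l : List (ℕ × ℤ)) : evalC g (shiftTab s l) = evalC (fun c => g (c + s)) l := by
  unfold shiftTab evalC
  rw [List.map_map]
  rfl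

/-- **The merge step evaluates like the branching step.** -/
theorem evalC_stepM (Bs : ℕ) (g : ℕ → ℝ) (l : List (ℕ × ℤ)) : ∀ cells : List ℕ, evalC g (stepM Bs cells l) = evalC g (stepU Bs cells l)
  | [] => by rw [evalC_stepU]; simp [stepM, evalC]
  | v :: cells => by
    rw [evalC_stepU, List.map_cons, List.sum_cons, stepM, evalC_perm g (merge2_perm _ _), evalC_append, evalC_shiftTab, evalC_stepM Bs g l cells,
      evalC_stepU]

/-- `tabM2` evaluates like the unmerged table `tabU` (hence like `tabM`). -/
theorem evalC_tabM2 (Bs A X B Y t : ℕ) : ∀ (n : ℕ) (g : ℕ → ℝ), evalC g (tabM2 Bs A X B Y t n) = evalC g (tabU Bs A X B Y t n)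
  | 0, _ => rfl
  | n + 1, g => by
    rw [tabM2, tabU_succ, evalC_aggr, evalC_stepM]
    exact evalC_stepU_congr Bs _ (fun g' => evalC_tabM2 Bs A X B Y t n g') g

/-- `tabF2` evaluates like `tabF`. -/
theorem evalC_tabF2 (Bs A X a b fuel : ℕ) : ∀ (n : ℕ) (g : ℕ → ℝ), evalC g (tabF2 Bs A X a b n) = evalC g (tabF Bs A X a b fuel n)
  | 0, _ => rfl
  | n + 1, g => by
    rw [tabF2, tabF, evalC_aggr, evalC_aggr, evalC_stepM, evalC_perm g (msort2_perm fuel _)]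
    exact evalC_stepU_congr Bs _ (fun g' => evalC_tabF2 Bs A X a b fuel n g') g

/-- `tabG2` evaluates like `tabG`. -/
theorem evalC_tabG2 (Bs A X a b fuel : ℕ) : ∀ (n : ℕ) (g : ℕ → ℝ), evalC g (tabG2 Bs A X a b n) = evalC g (tabG Bs A X a b fuel n)
  | 0, _ => rfl
  | n + 1, g => by
    rw [tabG2, tabG, evalC_aggr, evalC_aggr, evalC_stepM, evalC_perm g (msort2_perm fuel _)]
    exact evalC_stepU_congr Bs _ (fun g' => evalC_tabG2 Bs A X a b fuel n g') g

/-- Filtering by a key predicate commutes with evaluation-equality. -/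
theorem evalC_filter_congr (g : ℕ → ℝ) (P : ℕ → Bool) {l l' : List (ℕ × ℤ)} (h : ∀ g' : ℕ → ℝ, evalC g' l = evalC g' l') :
    evalC g (l.filter fun e => P e.1) = evalC g (l'.filter fun e => P e.1) := by
  rw [← evalC_filter, ← evalC_filter, h]

end

namespace SymCert3

variable (c : SymCert3)

/-- Fast `prodY`. -/
def prodY2 (A X B Y t : ℕ) (z : ℤ) : List (ℕ × ℤ) := c.keyTab false false (t == c.base.D) z (tabM2 c.Bs A X B Y t c.base.m)

/-- Fast `rowY`. -/
def rowY2 (r : RowE3) : List (ℕ × ℤ) :=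
  c.prodY2 (r.row.A ||| r.row.B) (r.row.X &&& r.row.Y) 0 (r.row.X ||| r.row.Y) r.t (-(r.row.n : ℤ)) ++ c.prodY2 r.row.A r.row.X r.row.B r.row.Y r.t (r.row.n : ℤ)

/-- Fast `linY`. -/
def linY2 (e : ℕ × ℕ × ℕ × ℕ) : List (ℕ × ℤ) :=
  (keyOfCode c.base.m c.Bs true (e.2.1 == c.base.D) (e.2.2.1 == c.base.D) (cvcode c.Bs c.base.m c.base.D e.2.1 e.2.2.1), -(e.2.2.2 : ℤ)) ::
    c.keyTab false (e.2.1 == c.base.D) (e.2.2.1 == c.base.D) (e.2.2.2 : ℤ) (tabF2 c.Bs 0 (2 ^ e.1) e.2.1 e.2.2.1 c.base.m)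

/-- Fast `ell2Y`. -/
def ell2Y2 (e : ℕ × ℕ × ℕ) : List (ℕ × ℤ) :=
  (keyOfCode c.base.m c.Bs true (e.1 == c.base.D) (e.2.1 == c.base.D) (cvcode c.Bs c.base.m c.base.D e.1 e.2.1), (e.2.2 : ℤ) * c.base.cN) ::
    c.keyTab false (e.1 == c.base.D) (e.2.1 == c.base.D) (-((e.2.2 : ℤ) * c.base.cD))
      ((tabF2 c.Bs 0 0 e.1 e.2.1 c.base.m).filter fun t => decide (c.base.h ≤ popcDigits c.Bs t.1))

noncomputable section

/-- A key-mapped table depends only on the evaluations of the table. -/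
theorem evalC_keyTab_congr (val : ℕ → ℝ) (di dj dk : Bool) (z : ℤ) {l l' : List (ℕ × ℤ)} (h : ∀ g : ℕ → ℝ, evalC g l = evalC g l') :
    evalC val (c.keyTab di dj dk z l) = evalC val (c.keyTab di dj dk z l') := by
  unfold keyTab; rw [evalC_map_key, evalC_map_key, h]

/-- `prodY2` evaluates like `prodY`. -/
theorem evalC_prodY2 (val : ℕ → ℝ) (A X B Y t : ℕ) (z : ℤ) : evalC val (c.prodY2 A X B Y t z) = evalC val (c.prodY A X B Y t z) :=
  c.evalC_keyTab_congr val _ _ _ z fun g => by rw [evalC_tabM2, evalC_tabM]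

/-- `rowY2` evaluates like `rowY`. -/
theorem evalC_rowY2 (val : ℕ → ℝ) (r : RowE3) : evalC val (c.rowY2 r) = evalC val (c.rowY r) := by
  unfold rowY2 rowY; rw [evalC_append, evalC_append, evalC_prodY2, evalC_prodY2]

/-- `linY2` evaluates like `linY`. -/
theorem evalC_linY2 (val : ℕ → ℝ) (e : ℕ × ℕ × ℕ × ℕ) : evalC val (c.linY2 e) = evalC val (c.linY e) := by
  unfold linY2 linY evalC
  rw [List.map_cons, List.sum_cons, List.map_cons, List.sum_cons]
  congr 1
  exact c.evalC_keyTab_congr val _ _ _ _ fun g => evalC_tabF2 _ _ _ _ _ fuelY _ g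

/-- `ell2Y2` evaluates like `ell2Y`. -/
theorem evalC_ell2Y2 (val : ℕ → ℝ) (e : ℕ × ℕ × ℕ) : evalC val (c.ell2Y2 e) = evalC val (c.ell2Y e) := by
  unfold ell2Y2 ell2Y evalC
  rw [List.map_cons, List.sum_cons, List.map_cons, List.sum_cons]
  congr 1
  exact c.evalC_keyTab_congr val _ _ _ _ fun g =>
    evalC_filter_congr g (fun x => decide (c.base.h ≤ popcDigits c.Bs x)) fun g' => evalC_tabF2 _ _ _ _ _ fuelY _ g'

end

end SymCert3

namespace SymCert3Z

variable (z : SymCert3Z)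

/-- Fast `pairY`. -/
def pairY2 (f g : FormZ) (t : ℕ) (zz : ℤ) : List (ℕ × ℤ) :=
  if f.kd = 0 then
    (if g.kd = 0 then z.toS.prodY2 f.p f.q g.p g.q t zz
     else z.toS.keyTab false (g.p == z.base.D) (t == z.base.D) zz (tabF2 z.toS.Bs f.p f.q g.p t z.base.m))
  else
    (if g.kd = 0 then z.toS.keyTab (f.p == z.base.D) false (t == z.base.D) zz (tabG2 z.toS.Bs g.p g.q f.p t z.base.m)
     else [(keyOfCode z.base.m z.toS.Bs (f.p == z.base.D) (g.p == z.base.D) (t == z.base.D) (cvcode z.toS.Bs z.base.m f.p g.p t), zz)])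

/-- Fast `sqY`. -/
def sqY2 (s : SqZ) : List (ℕ × ℤ) :=
  z.pairY2 s.f1 s.f1 s.t (-((s.n : ℤ) * s.a * s.a)) ++ z.pairY2 s.f1 s.f2 s.t ((s.n : ℤ) * s.a * s.b) ++
    z.pairY2 s.f2 s.f1 s.t ((s.n : ℤ) * s.a * s.b) ++ z.pairY2 s.f2 s.f2 s.t (-((s.n : ℤ) * s.b * s.b))

/-- **The fast type-space contribution list of a spec part.** -/
def contribsZ2 : List (ℕ × ℤ) :=
  (z.ell2.map z.toS.ell2Y2).flatten ++ (z.lin.map z.toS.linY2).flatten ++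
    (z.rows.map fun ch => (ch.map fun r => z.toS.rowY2 (r.toE z.base.m)).flatten).flatten ++ (z.sqs.map fun ch => (ch.map z.sqY2).flatten).flatten

/-- **The fast digest.** -/
def digestZ2 (fuel : ℕ) : List (ℕ × ℤ) := aggr (msort2 fuel z.contribsZ2)

noncomputable section

/-- `pairY2` evaluates like `pairY`. -/
theorem evalC_pairY2 (val : ℕ → ℝ) (f g : FormZ) (t : ℕ) (zz : ℤ) : evalC val (z.pairY2 f g t zz) = evalC val (z.pairY f g t zz) := by
  unfold pairY2 pairY
  by_cases hf : f.kd = 0 <;> by_cases hg : g.kd = 0 <;> simp only [hf, hg, if_true, if_false]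
  · exact z.toS.evalC_prodY2 val _ _ _ _ _ _
  · exact z.toS.evalC_keyTab_congr val _ _ _ _ fun g' => evalC_tabF2 _ _ _ _ _ SymCert3.fuelY _ g'
  · exact z.toS.evalC_keyTab_congr val _ _ _ _ fun g' => evalC_tabG2 _ _ _ _ _ SymCert3.fuelY _ g'

/-- `sqY2` evaluates like `sqY`. -/
theorem evalC_sqY2 (val : ℕ → ℝ) (s : SqZ) : evalC val (z.sqY2 s) = evalC val (z.sqY s) := by
  unfold sqY2 sqY
  simp only [evalC_append, evalC_pairY2]

/-- **The fast list evaluates like `contribsZ`.** -/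
theorem evalC_contribsZ2 (val : ℕ → ℝ) : evalC val z.contribsZ2 = evalC val z.contribsZ := by
  unfold contribsZ2 contribsZ
  rw [evalC_append, evalC_append, evalC_append, evalC_append, evalC_append, evalC_append,
    SymCert3.evalC_flatten_congr val _ _ _ (fun e _ => z.toS.evalC_ell2Y2 val e),
    SymCert3.evalC_flatten_congr val _ _ _ (fun e _ => z.toS.evalC_linY2 val e),
    SymCert3.evalC_flatten_congr val _ _ _ (fun ch _ => SymCert3.evalC_flatten_congr val _ _ _ fun r _ => z.toS.evalC_rowY2 val (r.toE z.base.m)),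
    SymCert3.evalC_flatten_congr val _ _ _ (fun ch _ => SymCert3.evalC_flatten_congr val _ _ _ fun s _ => z.evalC_sqY2 val s)]

/-- The fast digest evaluates like the enumerated contribution list of the translation. -/
theorem evalC_digestZ2 (hw : z.wfZ = true) (fuel : ℕ) (val : ℕ → ℝ) : evalC val (z.digestZ2 fuel) = evalC val z.toS.contribs3S := by
  unfold digestZ2
  rw [evalC_aggr, evalC_perm val (msort2_perm fuel _), z.evalC_contribsZ2, z.evalC_contribsZ hw]

/-- The parts' enumerated values are their fast digests' values. -/
theorem map_evalC_of_digestsZ2 (fuel : ℕ) (val : ℕ → ℝ) {l : List SymCert3Z} {D : List (List (ℕ × ℤ))}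
    (hw : ∀ d ∈ l, d.wfZ = true) (hD : List.Forall₂ (fun d dg => d.digestZ2 fuel = dg) l D) :
    ((l.map toS).map fun d => evalC val d.contribs3S) = D.map (evalC val) := by
  induction hD with
  | nil => rfl
  | @cons d dg l' D' hdg _ ih =>
    rw [List.map_cons, List.map_cons, List.map_cons, ih fun d' hd' => hw d' (List.mem_cons_of_mem _ hd'), ← hdg, evalC_digestZ2 d (hw d (by simp))]

/-- **NONNEGATIVITY OF A GLUED CERTIFICATE FROM THE SPEC PARTS' FAST DIGESTS.** -/
theorem pos_of_digestsZ2 (b : Cert) (l : List SymCert3Z) (hb : ∀ d ∈ l, d.base = b) (hw : ∀ d ∈ l, d.wfZ = true) (fuel : ℕ)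
    (D : List (List (ℕ × ℤ))) (hD : List.Forall₂ (fun d dg => d.digestZ2 fuel = dg) l D) (hruns : runsOK (msort2 fuel D.flatten) = true)
    (val : ℕ → ℝ) (hval : ∀ key, 0 ≤ val key) : 0 ≤ evalC val (SymCert3.concat b (l.map toS)).contribs3S := by
  rw [SymCert3.evalC_concat3 b val (l.map toS) (toS_bases b l hb), map_evalC_of_digestsZ2 fuel val hw hD, ← evalC_flatten]
  exact evalC_nonneg_of_runsOK_msort2 val hval fuel _ hruns

/-- **Two levels.** -/
theorem pos_of_superdigestsZ2 (b : Cert) (l : List SymCert3Z) (hb : ∀ d ∈ l, d.base = b) (hw : ∀ d ∈ l, d.wfZ = true) (fuel : ℕ)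
    (D : List (List (ℕ × ℤ))) (hD : List.Forall₂ (fun d dg => d.digestZ2 fuel = dg) l D) (G : List (List (List (ℕ × ℤ)))) (hG : G.flatten = D)
    (E : List (List (ℕ × ℤ))) (hE : List.Forall₂ (fun g e => aggr (msort2 fuel g.flatten) = e) G E)
    (hruns : runsOK (msort2 fuel E.flatten) = true) (val : ℕ → ℝ) (hval : ∀ key, 0 ≤ val key) :
    0 ≤ evalC val (SymCert3.concat b (l.map toS)).contribs3S := by
  rw [SymCert3.evalC_concat3 b val (l.map toS) (toS_bases b l hb), map_evalC_of_digestsZ2 fuel val hw hD, ← evalC_flatten, ← hG,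
    SymCert3.evalC_flatten_flatten, SymCert3.map_evalC_of_superdigests fuel val hE, ← evalC_flatten]
  exact evalC_nonneg_of_runsOK_msort2 val hval fuel _ hruns

/-- Smoke test (kernel): on the m = 3 smoke part the fast digest IS the digest (both are sorted and aggregated). -/
theorem zSmoke3_digestZ2 : zSmoke3.digestZ2 12 = zSmoke3.digestZ 12 := by
  decide +kernel

end

end SymCert3Z

end QCert
end HubOnly

end Summit.CriticalPhenomena.PercolationContinuityZ3.Theorems
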